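import Mathlib
import HarnessLib

/-!
# THRESHOLD CALCULUS FOR STUDENT-TYPE FUNCTIONALS `t ↦ μ{A ≤ t²·D}`:
# continuity from null level sets, the value at `0`, the limit `1`, and the existence of a
# threshold for every level `p ∈ (0, 1)`; plus: the sample variance of independent standard
# normals vanishes with probability `0`

HONEST FRAMING: exact (Metropolis-corrected) sampling algorithms for lattice gauge theory;
figures of merit are autocorrelation/cost numbers at stated couplings and volumes; no
continuum-physics claim.

Venture `LatticeQCDFlow` (cell pub-lqcd), topic `Scoring`; FANOUT row 4 (`s0-u1-b`, GEN-32).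
NEW WORK of the cell (classical; not in Mathlib), no definition, nothing cited as a fact.

The cell's fixed-batch-count / fixed-replica-count coverage limits are functionals
`F(t) = μ{ω | A ω ≤ t²·D ω}` of a finite measure `μ` (a product of standard Gaussians) with a
"numerator" `A ≥ 0` (`a·ḡ²`, `a·(ḡ − h̄)²`) and a "denominator" `D ≥ 0` (`s²(g)`, `s²(g) + s²(h)`).
This Mathlib-only file isolates the measure-theoretic steps that turn two pieces of Gaussian
information — the level sets `{A = t²·D}` are null, and `{D = 0}` is null — into the existence of
a threshold `t > 0` with `F(t) = p` for every nominal level `p ∈ (0, 1)`: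
continuity of `F` (dominated convergence of indicators, Mathlib's
`tendsto_measure_of_ae_tendsto_indicator_of_isFiniteMeasure`), `F(0) = 0`, `F(n) → 1`
(monotone union exhausting `{D > 0}`), and the intermediate value theorem.  It also proves the
second Gaussian input once: under `N(0,1)^{⊗(k+2)}` the sample variance vanishes with probability
`0` (the event lies in the hyperplane `{g₀ = g₁}` and `g₀ − g₁ ∼ N(0, 2)` has no atom).

## Content

* `continuous_measureReal_studentSublevel` — null level sets ⇒ `t ↦ μ.real {A ≤ t²·D}` continuous.
* `measureReal_studentSublevel_zero` — `A ≥ 0` and `{A = 0}` null ⇒ `F(0) = 0`.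
* `tendsto_measureReal_studentSublevel_atTop` — `D ≥ 0` and `{D = 0}` null ⇒ `F(n) → 1`.
* `exists_pos_threshold_of_continuous` — `F` continuous, `F 0 = 0`, `F n → 1` ⇒
  `∀ p ∈ (0,1), ∃ t > 0, F t = p`.
* `pi_gaussianReal_sampleVariance_eq_zero_null` — `N(0,1)^{⊗(k+2)}{∑ⱼ (gⱼ − ḡ)² = 0} = 0`.

Mathlib only.  [ours] throughout.
-/

open MeasureTheory ProbabilityTheory Filter Topology

namespace Summit.Ventures.LatticeQCDFlow.Scoring

section Generic

variable {Ω : Type*} [MeasurableSpace Ω]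

/-- **Continuity of `t ↦ μ{A ≤ t²·D}` from null level sets.**  If every level set
`{ω | A ω − t²·D ω = 0}` is `μ`-null, the sublevel probability is a continuous function of the
threshold (dominated convergence: off the level set at `t₀` the indicators converge). [ours] -/
theorem continuous_measureReal_studentSublevel (μ : Measure Ω) [IsFiniteMeasure μ]
    {A D : Ω → ℝ} (hA : Measurable A) (hD : Measurable D)
    (hnull : ∀ t : ℝ, μ {ω | A ω - t ^ 2 * D ω = 0} = 0) :
    Continuous fun t : ℝ => μ.real {ω | A ω ≤ t ^ 2 * D ω} := by
  have hE : ∀ t : ℝ, MeasurableSet {ω | A ω ≤ t ^ 2 * D ω} := fun t =>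
    measurableSet_le hA (hD.const_mul _)
  refine continuous_iff_continuousAt.2 fun t₀ => ?_
  have hlim : ∀ᵐ ω ∂μ, ∀ᶠ t in 𝓝 t₀,
      ω ∈ {ω | A ω ≤ t ^ 2 * D ω} ↔ ω ∈ {ω | A ω ≤ t₀ ^ 2 * D ω} := by
    rw [ae_iff]
    refine measure_mono_null (fun ω hω => ?_) (hnull t₀)
    simp only [Set.mem_setOf_eq] at hω ⊢
    by_contra hne
    apply hω
    have hct : ContinuousAt (fun t : ℝ => A ω - t ^ 2 * D ω) t₀ := by fun_prop
    rcases lt_or_gt_of_ne hne with hlt | hgt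
    · have hev : ∀ᶠ t in 𝓝 t₀, A ω - t ^ 2 * D ω < 0 := hct.eventually (gt_mem_nhds hlt)
      filter_upwards [hev] with t ht
      constructor
      · intro _; linarith
      · intro _; linarith
    · have hev : ∀ᶠ t in 𝓝 t₀, 0 < A ω - t ^ 2 * D ω := hct.eventually (lt_mem_nhds hgt)
      filter_upwards [hev] with t ht
      constructor
      · intro h; linarith
      · intro h; linarith
  have key := tendsto_measure_of_ae_tendsto_indicator_of_isFiniteMeasure (𝓝 t₀) (hE t₀) hE hlim
  have key' : Tendsto (fun t => μ.real {ω | A ω ≤ t ^ 2 * D ω}) (𝓝 t₀)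
      (𝓝 (μ.real {ω | A ω ≤ t₀ ^ 2 * D ω})) := by
    simp only [measureReal_def]
    exact (ENNReal.tendsto_toReal (measure_ne_top μ _)).comp key
  exact key'

/-- **`F(0) = 0`**: if `A ≥ 0` and the level set at `t = 0` is null then `μ{A ≤ 0²·D} = 0`. [ours] -/
theorem measureReal_studentSublevel_zero (μ : Measure Ω) {A D : Ω → ℝ} (hA0 : ∀ ω, 0 ≤ A ω)
    (hnull : μ {ω | A ω - (0 : ℝ) ^ 2 * D ω = 0} = 0) :
    μ.real {ω | A ω ≤ (0 : ℝ) ^ 2 * D ω} = 0 := by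
  have hsub : {ω | A ω ≤ (0 : ℝ) ^ 2 * D ω} ⊆ {ω | A ω - (0 : ℝ) ^ 2 * D ω = 0} := by
    intro ω hω
    simp only [Set.mem_setOf_eq, ne_eq, OfNat.ofNat_ne_zero, not_false_eq_true, zero_pow,
      zero_mul, sub_zero] at hω ⊢
    exact le_antisymm hω (hA0 ω)
  rw [measureReal_def, measure_mono_null hsub hnull, ENNReal.toReal_zero]

/-- **`F(n) → 1`**: if `D ≥ 0` and `{D = 0}` is null then `μ{A ≤ n²·D} → 1` along `n : ℕ` for a
probability measure `μ` (the events increase and exhaust `{D > 0}` by Archimedes). [ours] -/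
theorem tendsto_measureReal_studentSublevel_atTop (μ : Measure Ω) [IsProbabilityMeasure μ]
    {A D : Ω → ℝ} (hA : Measurable A) (hD : Measurable D) (hDnn : ∀ ω, 0 ≤ D ω)
    (hD0 : μ {ω | D ω = 0} = 0) :
    Tendsto (fun n : ℕ => μ.real {ω | A ω ≤ (n : ℝ) ^ 2 * D ω}) atTop (𝓝 1) := by
  have hmono : Monotone fun n : ℕ => {ω | A ω ≤ (n : ℝ) ^ 2 * D ω} := by
    intro m n hmn ω hω
    simp only [Set.mem_setOf_eq] at hω ⊢
    have hmn' : (m : ℝ) ^ 2 ≤ (n : ℝ) ^ 2 := by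
      have : (m : ℝ) ≤ n := by exact_mod_cast hmn
      nlinarith
    exact hω.trans (mul_le_mul_of_nonneg_right hmn' (hDnn ω))
  have hU := tendsto_measure_iUnion_atTop (μ := μ) hmono
  have hcompl : (⋃ n : ℕ, {ω | A ω ≤ (n : ℝ) ^ 2 * D ω})ᶜ ⊆ {ω | D ω = 0} := by
    intro ω hω
    simp only [Set.mem_compl_iff, Set.mem_iUnion, Set.mem_setOf_eq, not_exists, not_le] at hω
    simp only [Set.mem_setOf_eq]
    by_contra hne
    have hDpos : 0 < D ω := lt_of_le_of_ne (hDnn ω) (Ne.symm hne)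
    obtain ⟨n, hn⟩ := exists_nat_ge (A ω / D ω)
    have h1 : A ω ≤ (n : ℝ) * D ω := by
      rw [div_le_iff₀ hDpos] at hn
      exact hn
    have h2 : (n : ℝ) * D ω ≤ (n : ℝ) ^ 2 * D ω := by
      apply mul_le_mul_of_nonneg_right _ hDpos.le
      rcases Nat.eq_zero_or_pos n with h0 | h0
      · subst h0; simp
      · have : (1 : ℝ) ≤ n := by exact_mod_cast h0
        nlinarith
    exact absurd (h1.trans h2) (not_le.2 (hω n))
  have hfull : μ (⋃ n : ℕ, {ω | A ω ≤ (n : ℝ) ^ 2 * D ω}) = 1 := by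
    have h0 : μ (⋃ n : ℕ, {ω | A ω ≤ (n : ℝ) ^ 2 * D ω})ᶜ = 0 := measure_mono_null hcompl hD0
    have hmeas : MeasurableSet (⋃ n : ℕ, {ω | A ω ≤ (n : ℝ) ^ 2 * D ω}) :=
      MeasurableSet.iUnion fun n => measurableSet_le hA (hD.const_mul _)
    have := measure_add_measure_compl (μ := μ) hmeas
    rw [h0, add_zero, measure_univ] at this
    exact this
  rw [hfull] at hU
  have hU' := (ENNReal.tendsto_toReal ENNReal.one_ne_top).comp hU
  rw [ENNReal.toReal_one] at hU'
  simp only [measureReal_def]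
  exact hU'

/-- **A threshold exists for every level.**  A continuous `F : ℝ → ℝ` with `F 0 = 0` and
`F n → 1` takes every value `p ∈ (0, 1)` at some `t > 0` (intermediate value theorem). [ours] -/
theorem exists_pos_threshold_of_continuous {F : ℝ → ℝ} (hc : Continuous F) (h0 : F 0 = 0)
    (hlim : Tendsto (fun n : ℕ => F n) atTop (𝓝 1)) {p : ℝ} (hp0 : 0 < p) (hp1 : p < 1) :
    ∃ t : ℝ, 0 < t ∧ F t = p := by
  obtain ⟨n, hn⟩ := (hlim.eventually (lt_mem_nhds hp1)).exists
  have hn0 : (0 : ℝ) ≤ n := Nat.cast_nonneg n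
  have hmem : p ∈ Set.Icc (F 0) (F n) := ⟨by rw [h0]; exact hp0.le, hn.le⟩
  obtain ⟨t, ht, hFt⟩ := intermediate_value_Icc hn0 hc.continuousOn hmem
  refine ⟨t, ?_, hFt⟩
  rcases eq_or_lt_of_le ht.1 with h | h
  · exfalso
    rw [← h, h0] at hFt
    exact hp0.ne hFt
  · exact h

end Generic

section Gaussian

/-- **The sample variance of `k + 2 ≥ 2` independent standard normals vanishes with probability
`0`** (the event lies in the hyperplane `{g₀ = g₁}`, and `g₀ − g₁ ∼ N(0, 2)` has no atom). [ours] -/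
theorem pi_gaussianReal_sampleVariance_eq_zero_null (k : ℕ) :
    Measure.pi (fun _ : Fin (k + 2) => gaussianReal 0 1)
      {x : Fin (k + 2) → ℝ | ∑ j, (x j - (∑ i, x i) / ((k + 2 : ℕ) : ℝ)) ^ 2 = 0} = 0 := by
  set μs : Fin (k + 2) → Measure ℝ := fun _ => gaussianReal 0 1 with hμs
  have hsub : {x : Fin (k + 2) → ℝ | ∑ j, (x j - (∑ i, x i) / ((k + 2 : ℕ) : ℝ)) ^ 2 = 0}
      ⊆ (fun x : Fin (k + 2) → ℝ => x 0 - x 1) ⁻¹' {0} := by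
    intro x hx
    simp only [Set.mem_setOf_eq] at hx
    rw [Finset.sum_eq_zero_iff_of_nonneg (fun j _ => sq_nonneg _)] at hx
    have h0 : x 0 - (∑ i, x i) / ((k + 2 : ℕ) : ℝ) = 0 :=
      (pow_eq_zero_iff two_ne_zero).1 (hx 0 (Finset.mem_univ _))
    have h1 : x 1 - (∑ i, x i) / ((k + 2 : ℕ) : ℝ) = 0 :=
      (pow_eq_zero_iff two_ne_zero).1 (hx 1 (Finset.mem_univ _))
    simp only [Set.mem_preimage, Set.mem_singleton_iff]
    linarith
  have hind : iIndepFun (fun (i : Fin (k + 2)) (x : Fin (k + 2) → ℝ) => x i) (Measure.pi μs) :=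
    iIndepFun_pi (X := fun _ (y : ℝ) => y) (fun _ => aemeasurable_id)
  have h01 : IndepFun (fun x : Fin (k + 2) → ℝ => x 0) (fun x : Fin (k + 2) → ℝ => x 1)
      (Measure.pi μs) :=
    hind.indepFun (by exact zero_ne_one)
  have hX0 : HasLaw (fun x : Fin (k + 2) → ℝ => x 0) (gaussianReal 0 1) (Measure.pi μs) :=
    (measurePreserving_eval μs 0).hasLaw
  have hX1 : HasLaw (fun x : Fin (k + 2) → ℝ => x 1) (gaussianReal 0 1) (Measure.pi μs) :=
    (measurePreserving_eval μs 1).hasLaw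
  have hneg := gaussianReal_neg hX1
  have hind' : IndepFun (fun x : Fin (k + 2) → ℝ => x 0) (-fun x : Fin (k + 2) → ℝ => x 1)
      (Measure.pi μs) :=
    h01.comp measurable_id measurable_neg
  have hsum := gaussianReal_add_gaussianReal_of_indepFun hind' hX0.map_eq hneg.map_eq
  rw [neg_zero, add_zero] at hsum
  have hm : Measurable (fun x : Fin (k + 2) → ℝ => x 0 - x 1) := by fun_prop
  have hD : (Measure.pi μs).map (fun x : Fin (k + 2) → ℝ => x 0 - x 1) = gaussianReal 0 (1 + 1) := by
    rw [← hsum]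
    congr 1
  refine measure_mono_null hsub ?_
  rw [← Measure.map_apply hm (measurableSet_singleton 0), hD]
  haveI : NullSingletonClass (gaussianReal (0 : ℝ) (1 + 1)) :=
    nullSingletonClass_gaussianReal (by norm_num)
  exact measure_singleton 0

end Gaussian

end Summit.Ventures.LatticeQCDFlow.Scoring
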